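import Summits.ValiantsHypothesis.ValiantsHypothesis.Theorems.KPlusLogSqLawTridiagonalRealStaticUnitSixConcordant

/-!
# Route «KPlusLogSqLaw», crux `WeakLifting` (stmt-ValiantsHypothesis-19561) — REAL side of the tridiagonal sector:
# the UNIT-COEFFICIENT sub-sector at size `6` — the DISCORDANT SIDE: at most two POSITIVE-TRIANGLE zeros (log-concavity)

HONEST FRAMING.  Helper theorems (`--supports stmt-ValiantsHypothesis-19561 --as helper`), seat val-sym-lift-p1 (g17), cell `pub-symmetroid`,
2026-08-28; sequel of `…UnitSixConcordant`.  Two-triangle gauge `D₆ = x^E(A·B − b₂·C·D)`, `A = 1 − b₀ − b₁`, `B = 1 − b₃ − b₄`, `C = 1 − b₀`,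
`D = 1 − b₄`, `b_t = x^{L_t}`.  On the DISCORDANT side of `x = 1` (both outer links recessive, `b₀, b₄ < 1`: `(0, 1)` when `L₀, L₄ > 0`) one has
`C, D ∈ (0, 1)`, so a zero has either both triangles positive (`A, B > 0`) or both negative (`A·B = b₂CD > 0`).  Proved here, for ALL exponent
data with `L₀, L₄ > 0`:
* `recessive_factor_logConvex` — `K'(x) = x^{L₁}/(1 − x^{L₀}) = Σ_{n≥0} x^{L₁+nL₀}` is strictly log-convex in `ln x` on `(0, 1)`
  (`K'(x^p z^q) < K'(x)^p K'(z)^q`, weighted AM–GM on `1 − y^{L₀}`), hence (`one_sub_recessive_factor_logConcave`) `1 − K'` is strictly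
  LOG-CONCAVE where it is positive: `(1 − K'(x))^p (1 − K'(z))^q < 1 − K'(x^p z^q)`;
* `unit_six_discordant_no_three_pos` — three zeros `0 < x < y < z < 1` with positive triangles are impossible (the product
  `(1 − b₁/C)(1 − b₃/D)` is strictly log-concave on the interval where both factors are positive, `b₂` is log-linear);
* **POSITIVE-TRIANGLE TWO LAW** (`card_posRoots_posTriangle_unit_six_le_two`): `L₀ > 0 ∧ L₄ > 0` ⇒ at most TWO zeros `x ∈ (0, 1)` with
  `1 − x^{L₀} − x^{L₁} > 0` (equivalently, by the sign rule `unit_six_discordant_triangle_signs`, with both triangles positive).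
Together with `…UnitSixConcordant`/`…Sharp`: for `L₀, L₄ > 0` the zeros are ≤ 1 above `1`, ≤ 2 positive-triangle zeros below `1`, plus the
NEGATIVE-TRIANGLE zeros below `1` (`A, B < 0`; the located third zero of class `+++−+` lives there) — the last uncounted chamber at size 6 on this
side.  Nothing here is an upper law for the register (α NO MOVER); nothing bears on `WeakLifting` / `TropicalB` (stmt-19771) in their windows,
Conjecture B, the Door-A registers, `MatrixDescartes` (stmt-18050) or VP ≠ VNP.
[this seat; folklore: weighted AM–GM, log-concavity]
-/

-- `Summit.ValiantsHypothesis.ValiantsHypothesis.…` repeats a component by the D-0017 layout (single-conjunct summit); the name is mandated.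
set_option linter.dupNamespace false
set_option autoImplicit false

namespace Summit.ValiantsHypothesis.ValiantsHypothesis.Theorems.KPlusLogSqLaw
namespace StaticTridiagonalRealUnit

open Polynomial Finset
open Summit.ValiantsHypothesis.ValiantsHypothesis.Theorems.KPlusLogSqLaw.StaticTridiagonalRealPotential (pathDet)
open Summit.ValiantsHypothesis.ValiantsHypothesis.Theorems.KPlusLogSqLaw.DefiniteInterpolation (exists_rpow_interp)

variable (d : ℕ → ℕ) (f : ℕ → ℕ)

/-! ### Strict log-convexity of the recessive factor and log-concavity of its complement -/

/-- `K'(x) = x^{L₁}/(1 − x^{L₀})` is strictly log-convex in `ln x` on `(0, 1)` (`L₀ > 0`). [this file] -/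
theorem recessive_factor_logConvex (L₀ L₁ : ℤ) (h0 : 0 < L₀) {x z p q : ℝ} (hx : 0 < x) (hxz : x < z) (hz : z < 1)
    (hp : 0 < p) (hq : 0 < q) (hpq : p + q = 1) :
    (x ^ p * z ^ q) ^ L₁ / (1 - (x ^ p * z ^ q) ^ L₀) < (x ^ L₁ / (1 - x ^ L₀)) ^ p * (z ^ L₁ / (1 - z ^ L₀)) ^ q := by
  have hz0 : 0 < z := hx.trans hxz
  have hx1 : x < 1 := hxz.trans hz
  set a := x ^ L₀ with ha
  set b := z ^ L₀ with hb
  have ha0 : 0 < a := zpow_pos hx _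
  have hb0 : 0 < b := zpow_pos hz0 _
  have ha1 : a < 1 := zpow_lt_one₀ hx hx1 h0
  have hb1 : b < 1 := zpow_lt_one₀ hz0 hz h0
  have hab : a ≠ b := by
    intro h
    have := zpow_lt_zpow_left₀ h0 hx.le hxz
    rw [← ha, ← hb, h] at this
    exact lt_irrefl _ this
  have num : (x ^ p * z ^ q) ^ L₁ = (x ^ L₁) ^ p * (z ^ L₁) ^ q := zpow_interp hx hz0 p q _
  have den : (x ^ p * z ^ q) ^ L₀ = a ^ p * b ^ q := zpow_interp hx hz0 p q _
  have hden : (1 - a) ^ p * (1 - b) ^ q < 1 - (x ^ p * z ^ q) ^ L₀ := by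
    rw [den]; exact compl_geom_mean_lt ha0 ha1 hb0 hb1 hab hp hq hpq
  have hpos : 0 < (1 - a) ^ p * (1 - b) ^ q :=
    mul_pos (Real.rpow_pos_of_pos (by linarith) p) (Real.rpow_pos_of_pos (by linarith) q)
  have hnum : 0 < (x ^ L₁) ^ p * (z ^ L₁) ^ q :=
    mul_pos (Real.rpow_pos_of_pos (zpow_pos hx _) p) (Real.rpow_pos_of_pos (zpow_pos hz0 _) q)
  rw [Real.div_rpow (zpow_pos hx _).le (by linarith), Real.div_rpow (zpow_pos hz0 _).le (by linarith), div_mul_div_comm, num]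
  exact div_lt_div_of_pos_left hnum hpos hden

/-- **the complement `1 − K'` is strictly log-concave where positive**: if `K'(x) < 1` and `K'(z) < 1` (`0 < x < z < 1`) then
`(1 − K'(x))^p (1 − K'(z))^q < 1 − K'(x^p z^q)` (and in particular `K'(x^p z^q) < 1`). [this file] -/
theorem one_sub_recessive_factor_logConcave (L₀ L₁ : ℤ) (h0 : 0 < L₀) {x z p q : ℝ} (hx : 0 < x) (hxz : x < z) (hz : z < 1)
    (hp : 0 < p) (hq : 0 < q) (hpq : p + q = 1)
    (hKx : x ^ L₁ / (1 - x ^ L₀) < 1) (hKz : z ^ L₁ / (1 - z ^ L₀) < 1) :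
    (1 - x ^ L₁ / (1 - x ^ L₀)) ^ p * (1 - z ^ L₁ / (1 - z ^ L₀)) ^ q <
      1 - (x ^ p * z ^ q) ^ L₁ / (1 - (x ^ p * z ^ q) ^ L₀) := by
  have hz0 : 0 < z := hx.trans hxz
  have hx1 : x < 1 := hxz.trans hz
  have kx : 0 < x ^ L₁ / (1 - x ^ L₀) := div_pos (zpow_pos hx _) (sub_pos.2 (zpow_lt_one₀ hx hx1 h0))
  have kz : 0 < z ^ L₁ / (1 - z ^ L₀) := div_pos (zpow_pos hz0 _) (sub_pos.2 (zpow_lt_one₀ hz0 hz h0))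
  have h1 := recessive_factor_logConvex L₀ L₁ h0 hx hxz hz hp hq hpq
  -- AM–GM twice: `K(x)^p K(z)^q ≤ pK(x) + qK(z)` and `(1−K(x))^p (1−K(z))^q ≤ p(1−K(x)) + q(1−K(z))`
  have h2 : (x ^ L₁ / (1 - x ^ L₀)) ^ p * (z ^ L₁ / (1 - z ^ L₀)) ^ q ≤
      p * (x ^ L₁ / (1 - x ^ L₀)) + q * (z ^ L₁ / (1 - z ^ L₀)) :=
    Real.geom_mean_le_arith_mean2_weighted hp.le hq.le kx.le kz.le hpq
  have h3 : (1 - x ^ L₁ / (1 - x ^ L₀)) ^ p * (1 - z ^ L₁ / (1 - z ^ L₀)) ^ q ≤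
      p * (1 - x ^ L₁ / (1 - x ^ L₀)) + q * (1 - z ^ L₁ / (1 - z ^ L₀)) :=
    Real.geom_mean_le_arith_mean2_weighted hp.le hq.le (by linarith) (by linarith) hpq
  nlinarith

/-! ### Signs of the triangles at a zero on the discordant side -/

/-- on the discordant side `(0, 1)` (`L₀, L₄ > 0`) a zero has its two triangles of the SAME strict sign. [this file] -/
theorem unit_six_discordant_triangle_signs (L₀ L₁ L₂ L₃ L₄ : ℤ) (h0 : 0 < L₀) (h4 : 0 < L₄) {x : ℝ} (hx : 0 < x) (hx1 : x < 1)
    (hr : (1 - x ^ L₀ - x ^ L₁) * (1 - x ^ L₃ - x ^ L₄) = x ^ L₂ * (1 - x ^ L₀) * (1 - x ^ L₄)) :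
    (0 < 1 - x ^ L₀ - x ^ L₁ ∧ 0 < 1 - x ^ L₃ - x ^ L₄) ∨ (1 - x ^ L₀ - x ^ L₁ < 0 ∧ 1 - x ^ L₃ - x ^ L₄ < 0) := by
  have c : 0 < 1 - x ^ L₀ := sub_pos.2 (zpow_lt_one₀ hx hx1 h0)
  have dd : 0 < 1 - x ^ L₄ := sub_pos.2 (zpow_lt_one₀ hx hx1 h4)
  have hR : 0 < x ^ L₂ * (1 - x ^ L₀) * (1 - x ^ L₄) := mul_pos (mul_pos (zpow_pos hx _) c) dd
  rw [← hr] at hR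
  rcases lt_trichotomy (1 - x ^ L₀ - x ^ L₁) 0 with hA | hA | hA
  · right; exact ⟨hA, by nlinarith⟩
  · rw [hA, zero_mul] at hR; exact absurd hR (lt_irrefl 0)
  · left; exact ⟨hA, by nlinarith⟩

/-- secular form of a positive-triangle zero on `(0, 1)`: `(1 − b₁/C)(1 − b₃/D) = b₂` with both factors in `(0, 1]`… precisely positive. -/
theorem unit_six_secular_lt_one_pos (L₀ L₁ L₂ L₃ L₄ : ℤ) (h0 : 0 < L₀) (h4 : 0 < L₄) {x : ℝ} (hx : 0 < x) (hx1 : x < 1)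
    (hr : (1 - x ^ L₀ - x ^ L₁) * (1 - x ^ L₃ - x ^ L₄) = x ^ L₂ * (1 - x ^ L₀) * (1 - x ^ L₄))
    (hA : 0 < 1 - x ^ L₀ - x ^ L₁) :
    (1 - x ^ L₁ / (1 - x ^ L₀)) * (1 - x ^ L₃ / (1 - x ^ L₄)) = x ^ L₂ ∧
      x ^ L₁ / (1 - x ^ L₀) < 1 ∧ x ^ L₃ / (1 - x ^ L₄) < 1 := by
  have c : 0 < 1 - x ^ L₀ := sub_pos.2 (zpow_lt_one₀ hx hx1 h0)
  have dd : 0 < 1 - x ^ L₄ := sub_pos.2 (zpow_lt_one₀ hx hx1 h4)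
  have hB : 0 < 1 - x ^ L₃ - x ^ L₄ := by
    rcases unit_six_discordant_triangle_signs L₀ L₁ L₂ L₃ L₄ h0 h4 hx hx1 hr with ⟨_, hB⟩ | ⟨hA', _⟩
    · exact hB
    · exact absurd hA (not_lt.2 hA'.le)
  refine ⟨?_, ?_, ?_⟩
  · field_simp; linarith
  · rw [div_lt_one c]; linarith
  · rw [div_lt_one dd]; linarith

/-! ### No three positive-triangle zeros -/

/-- **no three positive-triangle zeros on the discordant side** (`L₀, L₄ > 0`, `0 < x < y < z < 1`, triangles positive at `x` and `z`). [this file] -/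
theorem unit_six_discordant_no_three_pos (L₀ L₁ L₂ L₃ L₄ : ℤ) (h0 : 0 < L₀) (h4 : 0 < L₄)
    {x y z : ℝ} (hx : 0 < x) (hxy : x < y) (hyz : y < z) (hz : z < 1)
    (hxr : (1 - x ^ L₀ - x ^ L₁) * (1 - x ^ L₃ - x ^ L₄) = x ^ L₂ * (1 - x ^ L₀) * (1 - x ^ L₄))
    (hyr : (1 - y ^ L₀ - y ^ L₁) * (1 - y ^ L₃ - y ^ L₄) = y ^ L₂ * (1 - y ^ L₀) * (1 - y ^ L₄))
    (hzr : (1 - z ^ L₀ - z ^ L₁) * (1 - z ^ L₃ - z ^ L₄) = z ^ L₂ * (1 - z ^ L₀) * (1 - z ^ L₄))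
    (hAx : 0 < 1 - x ^ L₀ - x ^ L₁) (hAz : 0 < 1 - z ^ L₀ - z ^ L₁) : False := by
  have hy0 : 0 < y := hx.trans hxy
  have hz0 : 0 < z := hy0.trans hyz
  have hx1 : x < 1 := hxy.trans (hyz.trans hz)
  have hy1 : y < 1 := hyz.trans hz
  have hxz : x < z := hxy.trans hyz
  obtain ⟨p, q, hp, hq, hpq, hyw⟩ := exists_rpow_interp hx hxy hyz
  obtain ⟨fx, kx0, kx4⟩ := unit_six_secular_lt_one_pos L₀ L₁ L₂ L₃ L₄ h0 h4 hx hx1 hxr hAx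
  obtain ⟨fz, kz0, kz4⟩ := unit_six_secular_lt_one_pos L₀ L₁ L₂ L₃ L₄ h0 h4 hz0 hz hzr hAz
  -- log-concavity of both complements between `x` and `z`, evaluated at `y = x^p z^q`
  have g0 := one_sub_recessive_factor_logConcave L₀ L₁ h0 hx hxz hz hp hq hpq kx0 kz0
  have g4 := one_sub_recessive_factor_logConcave L₄ L₃ h4 hx hxz hz hp hq hpq kx4 kz4
  rw [hyw] at g0 g4
  have px0 : 0 < 1 - x ^ L₁ / (1 - x ^ L₀) := by linarith
  have px4 : 0 < 1 - x ^ L₃ / (1 - x ^ L₄) := by linarith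
  have pz0 : 0 < 1 - z ^ L₁ / (1 - z ^ L₀) := by linarith
  have pz4 : 0 < 1 - z ^ L₃ / (1 - z ^ L₄) := by linarith
  have lhs0 : 0 < (1 - x ^ L₁ / (1 - x ^ L₀)) ^ p * (1 - z ^ L₁ / (1 - z ^ L₀)) ^ q :=
    mul_pos (Real.rpow_pos_of_pos px0 p) (Real.rpow_pos_of_pos pz0 q)
  -- at `y` the triangles are positive (the positive region is an interval), so `y` satisfies the same secular form
  have cy : 0 < 1 - y ^ L₀ := sub_pos.2 (zpow_lt_one₀ hy0 hy1 h0)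
  have hKy : y ^ L₁ / (1 - y ^ L₀) < 1 := by
    have : 0 < (1 - x ^ L₁ / (1 - x ^ L₀)) ^ p * (1 - z ^ L₁ / (1 - z ^ L₀)) ^ q := lhs0
    linarith
  have hAy : 0 < 1 - y ^ L₀ - y ^ L₁ := by
    have h := (div_lt_one cy).1 hKy
    linarith
  obtain ⟨fy, -, -⟩ := unit_six_secular_lt_one_pos L₀ L₁ L₂ L₃ L₄ h0 h4 hy0 hy1 hyr hAy
  have prod : ((1 - x ^ L₁ / (1 - x ^ L₀)) * (1 - x ^ L₃ / (1 - x ^ L₄))) ^ p *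
        ((1 - z ^ L₁ / (1 - z ^ L₀)) * (1 - z ^ L₃ / (1 - z ^ L₄))) ^ q <
      (1 - y ^ L₁ / (1 - y ^ L₀)) * (1 - y ^ L₃ / (1 - y ^ L₄)) := by
    have := mul_lt_mul'' g0 g4 lhs0.le (mul_pos (Real.rpow_pos_of_pos px4 p) (Real.rpow_pos_of_pos pz4 q)).le
    rw [Real.mul_rpow px0.le px4.le, Real.mul_rpow pz0.le pz4.le]; linarith
  rw [fx, fy, fz, ← zpow_interp hx hz0 p q L₂, hyw] at prod
  exact lt_irrefl _ prod

/-- **POSITIVE-TRIANGLE TWO LAW (discordant side).**  If `L₀ > 0` and `L₄ > 0`, at most TWO determinant zeros `x ∈ (0, 1)` have a positive left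
triangle `1 − x^{L₀} − x^{L₁} > 0` (equivalently both triangles positive). [this file] -/
theorem card_posRoots_posTriangle_unit_six_le_two (h0 : 0 < (2 * f 0 : ℤ) - d 0 - d 1) (h4 : 0 < (2 * f 4 : ℤ) - d 4 - d 5) :
    ((pathDet (fun _ => (1 : ℝ)) d (fun _ => (1 : ℝ)) f 6).roots.toFinset.filter
      (fun x => 0 < x ∧ x < 1 ∧ 0 < 1 - x ^ ((2 * f 0 : ℤ) - d 0 - d 1) - x ^ ((2 * f 1 : ℤ) - d 1 - d 2))).card ≤ 2 := by
  set S := (pathDet (fun _ => (1 : ℝ)) d (fun _ => (1 : ℝ)) f 6).roots.toFinset.filter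
      (fun x => 0 < x ∧ x < 1 ∧ 0 < 1 - x ^ ((2 * f 0 : ℤ) - d 0 - d 1) - x ^ ((2 * f 1 : ℤ) - d 1 - d 2)) with hS
  have mem : ∀ x, x ∈ S → (0 < x ∧ x < 1 ∧ 0 < 1 - x ^ ((2 * f 0 : ℤ) - d 0 - d 1) - x ^ ((2 * f 1 : ℤ) - d 1 - d 2)) ∧
      (1 - x ^ ((2 * f 0 : ℤ) - d 0 - d 1) - x ^ ((2 * f 1 : ℤ) - d 1 - d 2)) *
      (1 - x ^ ((2 * f 3 : ℤ) - d 3 - d 4) - x ^ ((2 * f 4 : ℤ) - d 4 - d 5)) =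
      x ^ ((2 * f 2 : ℤ) - d 2 - d 3) * (1 - x ^ ((2 * f 0 : ℤ) - d 0 - d 1)) * (1 - x ^ ((2 * f 4 : ℤ) - d 4 - d 5)) := by
    intro x hx
    simp only [hS, Finset.mem_filter, Multiset.mem_toFinset, mem_roots', IsRoot.def] at hx
    exact ⟨hx.2, unit_six_root_eq d f hx.2.1 hx.1.2⟩
  by_contra h3
  obtain ⟨a, ha, b, hb, c, hc, hab, hac, hbc⟩ := Finset.two_lt_card.1 (show 2 < S.card by omega)
  obtain ⟨⟨ha0, ha1, haA⟩, har⟩ := mem a ha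
  obtain ⟨⟨hb0, hb1, hbA⟩, hbr⟩ := mem b hb
  obtain ⟨⟨hc0, hc1, hcA⟩, hcr⟩ := mem c hc
  rcases hab.lt_or_gt with hab | hba
  · rcases hbc.lt_or_gt with hbc | hcb
    · exact unit_six_discordant_no_three_pos _ _ _ _ _ h0 h4 ha0 hab hbc hc1 har hbr hcr haA hcA
    · rcases hac.lt_or_gt with hac | hca
      · exact unit_six_discordant_no_three_pos _ _ _ _ _ h0 h4 ha0 hac hcb hb1 har hcr hbr haA hbA
      · exact unit_six_discordant_no_three_pos _ _ _ _ _ h0 h4 hc0 hca hab hb1 hcr har hbr hcA hbA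
  · rcases hbc.lt_or_gt with hbc | hcb
    · rcases hac.lt_or_gt with hac | hca
      · exact unit_six_discordant_no_three_pos _ _ _ _ _ h0 h4 hb0 hba hac hc1 hbr har hcr hbA hcA
      · exact unit_six_discordant_no_three_pos _ _ _ _ _ h0 h4 hb0 hbc hca ha1 hbr hcr har hbA haA
    · exact unit_six_discordant_no_three_pos _ _ _ _ _ h0 h4 hc0 hcb hba ha1 hcr hbr har hcA haA

end StaticTridiagonalRealUnit
end Summit.ValiantsHypothesis.ValiantsHypothesis.Theorems.KPlusLogSqLaw
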